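import Summits.RiemannHypothesis.RiemannHypothesis.Theorems.WeilFormatCWindowSesq
import Summits.RiemannHypothesis.RiemannHypothesis.Theorems.WeilFormatCPolyFourier
import HarnessLib

/-!
# Format C, design C∞ (L2–II): the pole form of indicator and monomial windows

Route context: Fourier–Galerkin / Schur-complement certificates of Weil positivity on a window ("format C";
cell memo `run/shared/lean/pub/rh-explicit/rh-explicit-weil-10/FORMATC-DESIGN.md` §9.12.7–§9.12.11; supporting
stmt-RiemannHypothesis-0098; seat rh-explicit-weil-10).  Companion of `WeilFormatCPolyWindowIncrement.lean` (increments /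
prime block of monomial windows `x^j·1_{[−a,a]}`); this file is the POLE layer (the analogue of `WeilFormatCEntryPole.lean`):

* `integral_indicator_mul` — `∫_ℝ (1_{[−a,a]}f)·φ = ∫_{−a}^{a} f φ`;
* `weilPoleSesq_indicator` — the sesquilinear pole form
  `P(u,v) = 2(∫u cosh(x/2))conj(∫v cosh(x/2)) − 2(∫u sinh(x/2))conj(∫v sinh(x/2))` (`WeilFormatCDefs.weilPoleSesq`) of two
  indicator windows through window integrals;
* `integral_pow_mul_exp_eq_sum` — the real Laplace moments `∫_s^e x^j e^{cx} dx` in closed form (`c ≠ 0`; the real form of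
  `WeilFormatCPolyFourier.integral_pow_mul_cexp_eq_sum`), and `∫_{−a}^{a} x^j cosh(x/2)`, `∫_{−a}^{a} x^j sinh(x/2)` as half the
  sum / difference of the moments at `c = ±½`;
* `weilPoleSesq_indicator_pow` — `P(1x^j, 1x^k) = 2 C_j C_k − 2 S_j S_k` with `C_j = ∫_{−a}^{a} x^j cosh(x/2) dx`,
  `S_j = ∫_{−a}^{a} x^j sinh(x/2) dx` — a REAL number.

Pure calculus; standard axioms; no RH claim.
-/

set_option autoImplicit false
-- `Summit.RiemannHypothesis.RiemannHypothesis.…` is the layout-mandated namespace (summit = problem name).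
set_option linter.dupNamespace false

noncomputable section

open Complex Filter Set MeasureTheory
open scoped Real Topology ComplexConjugate

namespace Summit.RiemannHypothesis.RiemannHypothesis.Theorems.WeilFormatC

open Literature.NumberTheory.LFunctions

variable {a : ℝ}

/-! ## Window integrals of indicator windows -/

/-- `(1f)·φ` is the truncation of `f·φ`. -/
theorem indicator_mul_eq_indicator (a : ℝ) (f φ : ℝ → ℂ) :
    (fun x ↦ (Icc (-a) a).indicator f x * φ x) = (Icc (-a) a).indicator (fun x ↦ f x * φ x) := by
  funext x
  by_cases hx : x ∈ Icc (-a) a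
  · simp only [indicator_of_mem hx]
  · simp only [indicator_of_notMem hx, zero_mul]

/-- `∫_ℝ (1f)·φ = ∫_{−a}^{a} f φ` (`a ≥ 0`). -/
theorem integral_indicator_mul (ha : 0 ≤ a) (f φ : ℝ → ℂ) :
    ∫ x, (Icc (-a) a).indicator f x * φ x = ∫ x in (-a)..a, f x * φ x := by
  rw [indicator_mul_eq_indicator, integral_indicator measurableSet_Icc, integral_Icc_eq_integral_Ioc,
    ← intervalIntegral.integral_of_le (by linarith)]

/-- **The pole form of two indicator windows** (`a ≥ 0`):
`P(1f, 1g) = 2(∫_{−a}^{a} f cosh(x/2))conj(∫_{−a}^{a} g cosh(x/2)) − 2(∫_{−a}^{a} f sinh(x/2))conj(∫_{−a}^{a} g sinh(x/2))`. -/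
theorem weilPoleSesq_indicator (ha : 0 ≤ a) (f g : ℝ → ℂ) :
    weilPoleSesq ((Icc (-a) a).indicator f) ((Icc (-a) a).indicator g) =
      2 * (∫ x in (-a)..a, f x * (Real.cosh (x / 2) : ℂ)) * conj (∫ x in (-a)..a, g x * (Real.cosh (x / 2) : ℂ)) -
        2 * (∫ x in (-a)..a, f x * (Real.sinh (x / 2) : ℂ)) * conj (∫ x in (-a)..a, g x * (Real.sinh (x / 2) : ℂ)) := by
  unfold weilPoleSesq
  rw [integral_indicator_mul ha, integral_indicator_mul ha, integral_indicator_mul ha, integral_indicator_mul ha]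

/-! ## Real Laplace moments of monomials -/

/-- **Real Laplace moments of a monomial**: for real `c ≠ 0`,
`∫_s^e x^j e^{cx} dx = Σ_{k=0}^{j} (−1)^k j^{(k)} (e^{j−k} e^{ce} − s^{j−k} e^{cs}) / c^{k+1}` (`j^{(k)}` the descending factorial). -/
theorem integral_pow_mul_exp_eq_sum {c : ℝ} (hc : c ≠ 0) (j : ℕ) (s e : ℝ) :
    ∫ x in s..e, x ^ j * Real.exp (c * x) =
      ∑ k ∈ Finset.range (j + 1), (-1) ^ k * (j.descFactorial k : ℝ) *
        (e ^ (j - k) * Real.exp (c * e) - s ^ (j - k) * Real.exp (c * s)) / c ^ (k + 1) := by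
  have hc' : (c : ℂ) ≠ 0 := by exact_mod_cast hc
  have h := integral_pow_mul_cexp_eq_sum hc' j s e
  have lhs : ∫ x in s..e, ((x : ℂ)) ^ j * Complex.exp ((c : ℂ) * x) =
      ((∫ x in s..e, x ^ j * Real.exp (c * x) : ℝ) : ℂ) := by
    rw [← intervalIntegral.integral_ofReal]
    refine intervalIntegral.integral_congr fun x _ ↦ ?_
    push_cast
    rfl
  rw [lhs] at h
  have rhs : (∑ k ∈ Finset.range (j + 1), (-1 : ℂ) ^ k * (j.descFactorial k : ℂ) *
      (((e : ℂ)) ^ (j - k) * Complex.exp ((c : ℂ) * e) - ((s : ℂ)) ^ (j - k) * Complex.exp ((c : ℂ) * s)) /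
        (c : ℂ) ^ (k + 1)) =
      ((∑ k ∈ Finset.range (j + 1), (-1) ^ k * (j.descFactorial k : ℝ) *
        (e ^ (j - k) * Real.exp (c * e) - s ^ (j - k) * Real.exp (c * s)) / c ^ (k + 1) : ℝ) : ℂ) := by
    push_cast
    rfl
  rw [rhs] at h
  exact_mod_cast h

/-- `∫_{−a}^{a} x^j cosh(x/2) dx = ½(∫_{−a}^{a} x^j e^{x/2} dx + ∫_{−a}^{a} x^j e^{−x/2} dx)` (each moment in closed form by
`integral_pow_mul_exp_eq_sum` with `c = ±½`). -/
theorem integral_pow_mul_cosh_half (j : ℕ) (a : ℝ) :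
    ∫ x in (-a)..a, x ^ j * Real.cosh (x / 2) =
      ((∫ x in (-a)..a, x ^ j * Real.exp (1 / 2 * x)) + ∫ x in (-a)..a, x ^ j * Real.exp (-(1 / 2) * x)) / 2 := by
  have h : ∀ x : ℝ, x ^ j * Real.cosh (x / 2) =
      (x ^ j * Real.exp (1 / 2 * x) + x ^ j * Real.exp (-(1 / 2) * x)) / 2 := by
    intro x
    rw [Real.cosh_eq]
    rw [show x / 2 = 1 / 2 * x by ring, show -(1 / 2 * x) = -(1 / 2) * x by ring]
    ring
  simp_rw [h]
  rw [intervalIntegral.integral_div, intervalIntegral.integral_add]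
  · exact (by fun_prop : Continuous fun x : ℝ ↦ x ^ j * Real.exp (1 / 2 * x)).intervalIntegrable _ _
  · exact (by fun_prop : Continuous fun x : ℝ ↦ x ^ j * Real.exp (-(1 / 2) * x)).intervalIntegrable _ _

/-- `∫_{−a}^{a} x^j sinh(x/2) dx = ½(∫_{−a}^{a} x^j e^{x/2} dx − ∫_{−a}^{a} x^j e^{−x/2} dx)`. -/
theorem integral_pow_mul_sinh_half (j : ℕ) (a : ℝ) :
    ∫ x in (-a)..a, x ^ j * Real.sinh (x / 2) =
      ((∫ x in (-a)..a, x ^ j * Real.exp (1 / 2 * x)) - ∫ x in (-a)..a, x ^ j * Real.exp (-(1 / 2) * x)) / 2 := by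
  have h : ∀ x : ℝ, x ^ j * Real.sinh (x / 2) =
      (x ^ j * Real.exp (1 / 2 * x) - x ^ j * Real.exp (-(1 / 2) * x)) / 2 := by
    intro x
    rw [Real.sinh_eq]
    rw [show x / 2 = 1 / 2 * x by ring, show -(1 / 2 * x) = -(1 / 2) * x by ring]
    ring
  simp_rw [h]
  rw [intervalIntegral.integral_div, intervalIntegral.integral_sub]
  · exact (by fun_prop : Continuous fun x : ℝ ↦ x ^ j * Real.exp (1 / 2 * x)).intervalIntegrable _ _
  · exact (by fun_prop : Continuous fun x : ℝ ↦ x ^ j * Real.exp (-(1 / 2) * x)).intervalIntegrable _ _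

/-- **Closed form of the `cosh`-moment**: `∫_{−a}^{a} x^j cosh(x/2) dx` as an explicit finite sum in `e^{±a/2}`, powers of `a`
and descending factorials. -/
theorem integral_pow_mul_cosh_half_eq_sum (j : ℕ) (a : ℝ) :
    ∫ x in (-a)..a, x ^ j * Real.cosh (x / 2) =
      ((∑ k ∈ Finset.range (j + 1), (-1) ^ k * (j.descFactorial k : ℝ) *
          (a ^ (j - k) * Real.exp (1 / 2 * a) - (-a) ^ (j - k) * Real.exp (1 / 2 * (-a))) / (1 / 2) ^ (k + 1)) +
        ∑ k ∈ Finset.range (j + 1), (-1) ^ k * (j.descFactorial k : ℝ) *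
          (a ^ (j - k) * Real.exp (-(1 / 2) * a) - (-a) ^ (j - k) * Real.exp (-(1 / 2) * (-a))) / (-(1 / 2)) ^ (k + 1)) / 2 := by
  rw [integral_pow_mul_cosh_half, integral_pow_mul_exp_eq_sum (by norm_num) j (-a) a,
    integral_pow_mul_exp_eq_sum (by norm_num) j (-a) a]

/-- **Closed form of the `sinh`-moment**: `∫_{−a}^{a} x^j sinh(x/2) dx` as an explicit finite sum. -/
theorem integral_pow_mul_sinh_half_eq_sum (j : ℕ) (a : ℝ) :
    ∫ x in (-a)..a, x ^ j * Real.sinh (x / 2) =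
      ((∑ k ∈ Finset.range (j + 1), (-1) ^ k * (j.descFactorial k : ℝ) *
          (a ^ (j - k) * Real.exp (1 / 2 * a) - (-a) ^ (j - k) * Real.exp (1 / 2 * (-a))) / (1 / 2) ^ (k + 1)) -
        ∑ k ∈ Finset.range (j + 1), (-1) ^ k * (j.descFactorial k : ℝ) *
          (a ^ (j - k) * Real.exp (-(1 / 2) * a) - (-a) ^ (j - k) * Real.exp (-(1 / 2) * (-a))) / (-(1 / 2)) ^ (k + 1)) / 2 := by
  rw [integral_pow_mul_sinh_half, integral_pow_mul_exp_eq_sum (by norm_num) j (-a) a,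
    integral_pow_mul_exp_eq_sum (by norm_num) j (-a) a]

/-! ## The pole form of two monomial windows -/

/-- `∫_ℝ (1x^j)·cosh(x/2) = ∫_{−a}^{a} x^j cosh(x/2) dx` (a real number; `a ≥ 0`). -/
theorem integral_indicator_pow_mul_cosh (ha : 0 ≤ a) (j : ℕ) :
    ∫ x : ℝ, (Icc (-a) a).indicator (fun x : ℝ ↦ ((x : ℂ)) ^ j) x * (Real.cosh (x / 2) : ℂ) =
      ((∫ x in (-a)..a, x ^ j * Real.cosh (x / 2) : ℝ) : ℂ) := by
  rw [integral_indicator_mul ha, ← intervalIntegral.integral_ofReal]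
  refine intervalIntegral.integral_congr fun x _ ↦ ?_
  push_cast
  rfl

/-- `∫_ℝ (1x^j)·sinh(x/2) = ∫_{−a}^{a} x^j sinh(x/2) dx` (a real number; `a ≥ 0`). -/
theorem integral_indicator_pow_mul_sinh (ha : 0 ≤ a) (j : ℕ) :
    ∫ x : ℝ, (Icc (-a) a).indicator (fun x : ℝ ↦ ((x : ℂ)) ^ j) x * (Real.sinh (x / 2) : ℂ) =
      ((∫ x in (-a)..a, x ^ j * Real.sinh (x / 2) : ℝ) : ℂ) := by
  rw [integral_indicator_mul ha, ← intervalIntegral.integral_ofReal]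
  refine intervalIntegral.integral_congr fun x _ ↦ ?_
  push_cast
  rfl

/-- **The pole form of two monomial windows** (`a ≥ 0`), a REAL number:
`P(1x^j, 1x^k) = 2 C_j C_k − 2 S_j S_k`, `C_j = ∫_{−a}^{a} x^j cosh(x/2) dx`, `S_j = ∫_{−a}^{a} x^j sinh(x/2) dx`
(closed forms `integral_pow_mul_cosh_half_eq_sum` / `integral_pow_mul_sinh_half_eq_sum`). -/
theorem weilPoleSesq_indicator_pow (ha : 0 ≤ a) (j k : ℕ) :
    weilPoleSesq ((Icc (-a) a).indicator fun x : ℝ ↦ ((x : ℂ)) ^ j) ((Icc (-a) a).indicator fun x : ℝ ↦ ((x : ℂ)) ^ k) =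
      ((2 * (∫ x in (-a)..a, x ^ j * Real.cosh (x / 2)) * (∫ x in (-a)..a, x ^ k * Real.cosh (x / 2)) -
        2 * (∫ x in (-a)..a, x ^ j * Real.sinh (x / 2)) * (∫ x in (-a)..a, x ^ k * Real.sinh (x / 2)) : ℝ) : ℂ) := by
  unfold weilPoleSesq
  rw [integral_indicator_pow_mul_cosh ha, integral_indicator_pow_mul_cosh ha, integral_indicator_pow_mul_sinh ha,
    integral_indicator_pow_mul_sinh ha, Complex.conj_ofReal, Complex.conj_ofReal]
  push_cast
  ring

end Summit.RiemannHypothesis.RiemannHypothesis.Theorems.WeilFormatC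

end
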